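import Summits.CriticalPhenomena.PercolationContinuityZ3.Theorems.SahiMasterFamilyTotalCumulance

/-!
# Sahi's functional under a SUM OF TWO WEIGHTS: the all-orders convolution identity

Unit `prim-master-conj` (crux anchor stmt-CriticalPhenomena-4575, helper work), gen 16; memo
`run/shared/lean/prim/prim-l12/prim-master-conj/POINTWISE.md` §17.

For a finite type `α`, two real weights `μ₁, μ₂ : α → ℝ` (ANY signs, ANY total masses) and a family `h = (h_0,…,h_{n−1})` of real
functions, Sahi's functional `E_n` [Sahi2008; LiebSahi2021, Prop. 3.3] (the tree's `sahiE`, defined by the Lieb–Sahi recursion) satisfies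

  `E_n^{μ₁+μ₂}(h) = E_n^{μ₁}(h) + E_n^{μ₂}(h) − Σ_{A ⊆ {0,…,n−1}} E_{|A|}^{μ₁}(h_A) · E_{n−|A|}^{μ₂}(h_{Aᶜ})`

(`sahiE_add_weight`), where `h_A` is the sub-family indexed by `A` in increasing order and the two extreme terms `A = ∅`, `A = univ` of the
sum vanish by the tree's convention `E_0 := 0`.  In generating-function language (`1 − G`, `G = exp 𝔼 log(1 − Σ tᵢhᵢ)` [LiebSahi2021])
this is the multiplicativity `G^{μ₁+μ₂} = G^{μ₁}·G^{μ₂}`; here it is proved directly from the recursion by induction on `n` (the right-hand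
side satisfies the Lieb–Sahi recursion: restriction to a sub-family commutes with the update of a slot inside it and ignores updates outside it).
Not found in print for `E_n`; checked in exact arithmetic before the proof (seat code `code/test_star.py`).  It is the engine of the
ONE-COORDINATE EXPANSION of `E_k(μ_p; 1_U)` around a section (file `…SectionExpansion`): `μ_p = (μ_p − μ_{p[e↦1]}) + μ_{p[e↦1]}`.
Also here: the sub-family plumbing (`sahiE_sub_*`) and the splitting of a sum over the subsets of `Fin (n+2)` along `0 ∈ A` (`sum_finset_succ`).
No conjecture is asserted; no named facts; axioms standard. [this work]
-/

noncomputable section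

open scoped Classical

namespace Summit.CriticalPhenomena.PercolationContinuityZ3.Theorems

open Finset Function
open Literature.Combinatorics.Sahi2008
open SahiTotalCumulance (sahiE_cast' orderEmbOfFin_map_succ card_insert_zero_map_succ orderEmbOfFin_insert_zero_map_succ
  sum_eq_sum_orderEmbOfFin)

namespace WeightSum

variable {α : Type*} [Fintype α]

/-! ### Expectations under a sum of weights -/

omit [Fintype α] in
/-- Pointwise sum of weights. [folklore] -/
theorem add_weight_apply (μ₁ μ₂ : α → ℝ) (x : α) : (μ₁ + μ₂) x = μ₁ x + μ₂ x := rfl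

/-- `E^{μ₁+μ₂} f = E^{μ₁} f + E^{μ₂} f`. [folklore] -/
theorem ex_add_weight (μ₁ μ₂ : α → ℝ) (f : α → ℝ) : ex (μ₁ + μ₂) f = ex μ₁ f + ex μ₂ f := by
  simp only [ex_def, Pi.add_apply, add_mul, Finset.sum_add_distrib]

/-! ### Sub-families: restriction along the increasing enumeration of a finset of slots -/

section Sub

variable {β : Type*} {n : ℕ}

omit [Fintype α] in
/-- Updating a slot outside `A` does not change the sub-family indexed by `A`. [folklore] -/
theorem sub_update_of_not_mem (g : Fin n → β) (A : Finset (Fin n)) {l : Fin n} (hl : l ∉ A) (v : β) :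
    (fun j : Fin A.card => update g l v (A.orderEmbOfFin rfl j)) = fun j => g (A.orderEmbOfFin rfl j) := by
  funext j
  rw [update_of_ne]
  exact fun h => hl (h ▸ Finset.orderEmbOfFin_mem A rfl j)

omit [Fintype α] in
/-- Updating the slot `A.orderEmbOfFin j` of `g` is, on the sub-family indexed by `A`, updating its slot `j`. [folklore] -/
theorem sub_update_orderEmbOfFin (g : Fin n → β) (A : Finset (Fin n)) (j : Fin A.card) (v : β) :
    (fun i : Fin A.card => update g (A.orderEmbOfFin rfl j) v (A.orderEmbOfFin rfl i)) =
      update (fun i => g (A.orderEmbOfFin rfl i)) j v := by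
  funext i
  by_cases hij : i = j
  · subst hij; rw [update_self, update_self]
  · rw [update_of_ne ((A.orderEmbOfFin rfl).injective.ne hij), update_of_ne hij]

/-- The sub-family indexed by `univ` is the family (up to the cast `card univ = n`). [folklore] -/
theorem sahiE_sub_univ (μ : α → ℝ) (g : Fin n → α → ℝ) :
    sahiE μ (univ : Finset (Fin n)).card (fun j => g ((univ : Finset (Fin n)).orderEmbOfFin rfl j)) = sahiE μ n g := by
  have hc : (univ : Finset (Fin n)).card = n := Finset.card_fin n
  have e : (fun j : Fin (univ : Finset (Fin n)).card => g ((univ : Finset (Fin n)).orderEmbOfFin rfl j)) =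
      fun j => g (Fin.cast hc j) := by
    funext j
    congr 1
    have huniq : (fun j : Fin n => j) = ((univ : Finset (Fin n)).orderEmbOfFin hc : Fin n → Fin n) :=
      Finset.orderEmbOfFin_unique hc (fun j => mem_univ j) strictMono_id
    have h1 : (univ : Finset (Fin n)).orderEmbOfFin rfl j = (univ : Finset (Fin n)).orderEmbOfFin hc (Fin.cast hc j) :=
      Finset.orderEmbOfFin_eq_orderEmbOfFin_iff.mpr rfl
    rw [h1]
    exact (congrFun huniq (Fin.cast hc j)).symm
  rw [e]
  exact sahiE_cast' μ hc g

/-- The sub-family of the empty set of slots has `E_0 = 0` (the tree's junk value). [folklore] -/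
theorem sahiE_sub_empty (μ : α → ℝ) (g : Fin n → α → ℝ) :
    sahiE μ (∅ : Finset (Fin n)).card (fun j => g ((∅ : Finset (Fin n)).orderEmbOfFin rfl j)) = 0 := by
  have hc : (∅ : Finset (Fin n)).card = 0 := Finset.card_empty
  rw [← sahiE_cast' μ hc.symm]
  · exact sahiE_zero μ _

/-- Sub-families of `cons f g` indexed by `A.map succ` are the sub-families of `g` indexed by `A`. [folklore] -/
theorem sahiE_sub_cons_map_succ (μ : α → ℝ) (f : α → ℝ) (g : Fin (n + 1) → α → ℝ) (A : Finset (Fin (n + 1))) :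
    sahiE μ (A.map (Fin.succEmb (n + 1))).card
        (fun j => (Matrix.vecCons f g : Fin (n + 2) → α → ℝ) ((A.map (Fin.succEmb (n + 1))).orderEmbOfFin rfl j)) =
      sahiE μ A.card (fun j => g (A.orderEmbOfFin rfl j)) := by
  have hc : A.card = (A.map (Fin.succEmb (n + 1))).card := (card_map _).symm
  rw [← sahiE_cast' μ hc]
  congr 1
  funext j
  have h1 : (A.map (Fin.succEmb (n + 1))).orderEmbOfFin rfl (Fin.cast hc j) =
      (A.map (Fin.succEmb (n + 1))).orderEmbOfFin (card_map _) j :=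
    Finset.orderEmbOfFin_eq_orderEmbOfFin_iff.mpr rfl
  rw [h1, orderEmbOfFin_map_succ]
  rfl

/-- Sub-families of `cons f g` indexed by `insert 0 (A.map succ)` are `cons f (g_A)`. [folklore] -/
theorem sahiE_sub_cons_insert_zero (μ : α → ℝ) (f : α → ℝ) (g : Fin (n + 1) → α → ℝ) (A : Finset (Fin (n + 1))) :
    sahiE μ (insert (0 : Fin (n + 2)) (A.map (Fin.succEmb (n + 1)))).card
        (fun j => (Matrix.vecCons f g : Fin (n + 2) → α → ℝ)
          ((insert (0 : Fin (n + 2)) (A.map (Fin.succEmb (n + 1)))).orderEmbOfFin rfl j)) =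
      sahiE μ (A.card + 1) (Matrix.vecCons f (fun j => g (A.orderEmbOfFin rfl j)) : Fin (A.card + 1) → α → ℝ) := by
  have hc : A.card + 1 = (insert (0 : Fin (n + 2)) (A.map (Fin.succEmb (n + 1)))).card := (card_insert_zero_map_succ A).symm
  rw [← sahiE_cast' μ hc]
  congr 1
  funext j
  have h1 : (insert (0 : Fin (n + 2)) (A.map (Fin.succEmb (n + 1)))).orderEmbOfFin rfl (Fin.cast hc j) =
      (insert (0 : Fin (n + 2)) (A.map (Fin.succEmb (n + 1)))).orderEmbOfFin (card_insert_zero_map_succ A) j :=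
    Finset.orderEmbOfFin_eq_orderEmbOfFin_iff.mpr rfl
  rw [h1, orderEmbOfFin_insert_zero_map_succ]
  refine Fin.cases ?_ (fun j' => ?_) j
  · simp
  · simp

end Sub

/-! ### Splitting a sum over the subsets of `Fin (n+2)` along `0 ∈ A` -/

section Split

variable {M : Type*} [AddCommMonoid M] {n : ℕ}

omit [Fintype α] in
/-- Sum over the subsets of a mapped finset. [folklore] -/
theorem sum_powerset_map {γ δ : Type*} (e : γ ↪ δ) (s : Finset γ) (F : Finset δ → M) :
    ∑ t ∈ (s.map e).powerset, F t = ∑ t ∈ s.powerset, F (t.map e) := by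
  have hmap : (s.map e).powerset = s.powerset.map (Finset.mapEmbedding e).toEmbedding := by
    ext t
    simp only [mem_powerset, mem_map, RelEmbedding.coe_toEmbedding, Finset.mapEmbedding_apply]
    constructor
    · intro ht
      obtain ⟨u, hu, rfl⟩ := Finset.subset_map_iff.mp ht
      exact ⟨u, hu, rfl⟩
    · rintro ⟨u, hu, rfl⟩
      exact Finset.map_subset_map.mpr hu
  rw [hmap, Finset.sum_map]
  rfl

omit [Fintype α] in
/-- **Splitting the sum over all subsets of `Fin (n+2)`** by whether they contain `0`: every subset is `A.map succ` or
`insert 0 (A.map succ)` for a unique `A ⊆ Fin (n+1)`. [folklore] -/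
theorem sum_finset_succ (F : Finset (Fin (n + 2)) → M) :
    ∑ A : Finset (Fin (n + 2)), F A =
      ∑ A : Finset (Fin (n + 1)), (F (A.map (Fin.succEmb (n + 1))) + F (insert (0 : Fin (n + 2)) (A.map (Fin.succEmb (n + 1))))) := by
  have huniv : (univ : Finset (Fin (n + 2))) = insert (0 : Fin (n + 2)) ((univ : Finset (Fin (n + 1))).map (Fin.succEmb (n + 1))) := by
    rw [Fin.univ_succ, Finset.cons_eq_insert]
    rfl
  have h0 : (0 : Fin (n + 2)) ∉ (univ : Finset (Fin (n + 1))).map (Fin.succEmb (n + 1)) := by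
    simp [Fin.succ_ne_zero]
  rw [← Finset.powerset_univ, huniv, Finset.sum_powerset_insert h0, sum_powerset_map, sum_powerset_map,
    ← Finset.sum_add_distrib, Finset.powerset_univ]

omit [Fintype α] in
/-- Complement of `A.map succ` in `Fin (n+2)`. [folklore] -/
theorem compl_map_succ (A : Finset (Fin (n + 1))) :
    (A.map (Fin.succEmb (n + 1)))ᶜ = insert (0 : Fin (n + 2)) (Aᶜ.map (Fin.succEmb (n + 1))) := by
  ext x
  refine Fin.cases ?_ (fun i => ?_) x
  · simp [Fin.succ_ne_zero]
  · simp [Fin.succ_ne_zero, Fin.succ_inj]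

omit [Fintype α] in
/-- Complement of `insert 0 (A.map succ)` in `Fin (n+2)`. [folklore] -/
theorem compl_insert_zero_map_succ (A : Finset (Fin (n + 1))) :
    (insert (0 : Fin (n + 2)) (A.map (Fin.succEmb (n + 1))))ᶜ = Aᶜ.map (Fin.succEmb (n + 1)) := by
  ext x
  refine Fin.cases ?_ (fun i => ?_) x
  · simp [Fin.succ_ne_zero]
  · simp [Fin.succ_ne_zero, Fin.succ_inj]

end Split

/-! ### The recursion with the order-one correction, and a congruence lemma -/

section Rec

variable {n : ℕ}

/-- The Lieb–Sahi head recursion for `k + 1` functions, uniformly in `k` (for `k = 0` the tree's junk `E_0 = 0` costs the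
correction `E(f)`). [folklore; LiebSahi2021 Prop. 3.3] -/
theorem sahiE_cons_rec_ite (μ : α → ℝ) {k : ℕ} (f : α → ℝ) (G : Fin k → α → ℝ) :
    sahiE μ (k + 1) (Matrix.vecCons f G : Fin (k + 1) → α → ℝ) =
      (∑ j : Fin k, sahiE μ k (update G j (G j * f))) - sahiE μ k G * ex μ f + (if k = 0 then ex μ f else 0) := by
  cases k with
  | zero => simp [sahiE_one_apply, sahiE_zero]
  | succ k => rw [sahiE_cons, if_neg (Nat.succ_ne_zero k), add_zero]

/-- Sub-family functionals along equal index sets agree (dependent rewriting helper). [folklore] -/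
theorem sahiE_sub_congr (μ : α → ℝ) (g : Fin n → α → ℝ) {A B : Finset (Fin n)} (hAB : A = B) :
    sahiE μ A.card (fun j => g (A.orderEmbOfFin rfl j)) = sahiE μ B.card (fun j => g (B.orderEmbOfFin rfl j)) := by
  subst hAB; rfl

/-- A sub-family indexed by a set of `0` slots has functional `E_0 = 0`. [folklore] -/
theorem sahiE_sub_eq_zero_of_card (μ : α → ℝ) (g : Fin n → α → ℝ) {A : Finset (Fin n)} (hA : A.card = 0) :
    sahiE μ A.card (fun j => g (A.orderEmbOfFin rfl j)) = 0 := by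
  obtain rfl := Finset.card_eq_zero.mp hA
  exact sahiE_sub_empty μ g

/-- Inside a sub-family: the sum over the slots `l ∈ A` of the functional of `g` updated at `l` is the head-recursion sum of the
sub-family `g_A`. [folklore] -/
theorem sum_sub_update_mem (μ : α → ℝ) (g : Fin (n + 1) → α → ℝ) (f : α → ℝ) (A : Finset (Fin (n + 1))) :
    ∑ l ∈ A, sahiE μ A.card (fun j => update g l (g l * f) (A.orderEmbOfFin rfl j)) =
      ∑ j : Fin A.card, sahiE μ A.card
        (update (fun i => g (A.orderEmbOfFin rfl i)) j ((fun i => g (A.orderEmbOfFin rfl i)) j * f)) := by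
  rw [sum_eq_sum_orderEmbOfFin A (fun l => sahiE μ A.card (fun j => update g l (g l * f) (A.orderEmbOfFin rfl j)))]
  refine Finset.sum_congr rfl fun j _ => ?_
  rw [sub_update_orderEmbOfFin]

end Rec

/-! ### The identity -/

/-- **Sahi's functional under a sum of two weights** (all orders, any real weights, any functions):
`E_n^{μ₁+μ₂}(h) = E_n^{μ₁}(h) + E_n^{μ₂}(h) − Σ_{A} E^{μ₁}_{|A|}(h_A)·E^{μ₂}_{n−|A|}(h_{Aᶜ})`, the sum over all sets of slots
`A ⊆ {0,…,n−1}` (the terms `A = ∅`, `A = univ` vanish, `E_0 = 0`).  Generating-function form: `G^{μ₁+μ₂} = G^{μ₁}G^{μ₂}`. [this work] -/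
theorem sahiE_add_weight (μ₁ μ₂ : α → ℝ) : ∀ (n : ℕ) (h : Fin n → α → ℝ),
    sahiE (μ₁ + μ₂) n h = sahiE μ₁ n h + sahiE μ₂ n h -
      ∑ A : Finset (Fin n), sahiE μ₁ A.card (fun j => h (A.orderEmbOfFin rfl j)) *
        sahiE μ₂ Aᶜ.card (fun j => h (Aᶜ.orderEmbOfFin rfl j))
  | 0, h => by
    rw [sahiE_zero, sahiE_zero, sahiE_zero, Finset.sum_eq_zero fun A _ => ?_]
    · ring
    · rw [sahiE_sub_eq_zero_of_card μ₁ h (Finset.card_eq_zero.mpr (Finset.eq_empty_of_isEmpty A)), zero_mul]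
  | 1, h => by
    rw [sahiE_one_apply, sahiE_one_apply, sahiE_one_apply, ex_add_weight, Finset.sum_eq_zero fun A _ => ?_]
    · ring
    · by_cases hA : A = ∅
      · rw [sahiE_sub_eq_zero_of_card μ₁ h (Finset.card_eq_zero.mpr hA), zero_mul]
      · have hAc : Aᶜ = ∅ := by
          have hAu : A = univ := by
            obtain ⟨x, hx⟩ := Finset.nonempty_iff_ne_empty.mpr hA
            exact Finset.eq_univ_of_forall fun y => by rwa [Subsingleton.elim y x]
          rw [hAu, Finset.compl_univ]
        rw [sahiE_sub_eq_zero_of_card μ₂ h (Finset.card_eq_zero.mpr hAc), mul_zero]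
  | n + 2, h => by
    obtain ⟨f, g, rfl⟩ : ∃ (f : α → ℝ) (g : Fin (n + 1) → α → ℝ), h = Matrix.vecCons f g :=
      ⟨h 0, Fin.tail h, (Fin.cons_self_tail h).symm⟩
    -- shorthands
    set ρ : α → ℝ := μ₁ + μ₂ with hρ
    -- the induction hypotheses (order `n + 1`)
    have IH := sahiE_add_weight μ₁ μ₂ (n + 1)
    -- (1) recursions at the head, three weights
    have Rρ := sahiE_cons ρ n f g
    have R1 := sahiE_cons μ₁ n f g
    have R2 := sahiE_cons μ₂ n f g
    have Xρ : ex ρ f = ex μ₁ f + ex μ₂ f := ex_add_weight μ₁ μ₂ f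
    -- (2) the per-`A` identity
    have PER : ∀ A : Finset (Fin (n + 1)),
        ∑ l : Fin (n + 1), sahiE μ₁ A.card (fun j => update g l (g l * f) (A.orderEmbOfFin rfl j)) *
            sahiE μ₂ Aᶜ.card (fun j => update g l (g l * f) (Aᶜ.orderEmbOfFin rfl j)) =
          sahiE μ₁ (insert (0 : Fin (n + 2)) (A.map (Fin.succEmb (n + 1)))).card
              (fun j => (Matrix.vecCons f g : Fin (n + 2) → α → ℝ)
                ((insert (0 : Fin (n + 2)) (A.map (Fin.succEmb (n + 1)))).orderEmbOfFin rfl j)) *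
            sahiE μ₂ (insert (0 : Fin (n + 2)) (A.map (Fin.succEmb (n + 1))))ᶜ.card
              (fun j => (Matrix.vecCons f g : Fin (n + 2) → α → ℝ)
                ((insert (0 : Fin (n + 2)) (A.map (Fin.succEmb (n + 1))))ᶜ.orderEmbOfFin rfl j)) +
          sahiE μ₁ (A.map (Fin.succEmb (n + 1))).card
              (fun j => (Matrix.vecCons f g : Fin (n + 2) → α → ℝ) ((A.map (Fin.succEmb (n + 1))).orderEmbOfFin rfl j)) *
            sahiE μ₂ (A.map (Fin.succEmb (n + 1)))ᶜ.card
              (fun j => (Matrix.vecCons f g : Fin (n + 2) → α → ℝ) ((A.map (Fin.succEmb (n + 1)))ᶜ.orderEmbOfFin rfl j)) +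
          (ex μ₁ f + ex μ₂ f) * (sahiE μ₁ A.card (fun j => g (A.orderEmbOfFin rfl j)) *
            sahiE μ₂ Aᶜ.card (fun j => g (Aᶜ.orderEmbOfFin rfl j))) -
          (if A = ∅ then ex μ₁ f * sahiE μ₂ (n + 1) g else 0) -
          (if A = univ then ex μ₂ f * sahiE μ₁ (n + 1) g else 0) := by
      intro A
      -- the four sub-families of `cons f g`
      rw [sahiE_sub_congr μ₂ _ (compl_insert_zero_map_succ A), sahiE_sub_congr μ₂ _ (compl_map_succ A),
        sahiE_sub_cons_insert_zero, sahiE_sub_cons_map_succ, sahiE_sub_cons_map_succ, sahiE_sub_cons_insert_zero,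
        sahiE_cons_rec_ite μ₁ f (fun j => g (A.orderEmbOfFin rfl j)),
        sahiE_cons_rec_ite μ₂ f (fun j => g (Aᶜ.orderEmbOfFin rfl j))]
      -- the left-hand side: split `l ∈ A` / `l ∈ Aᶜ`
      rw [← Finset.sum_add_sum_compl A]
      have hin : ∑ l ∈ A, sahiE μ₁ A.card (fun j => update g l (g l * f) (A.orderEmbOfFin rfl j)) *
            sahiE μ₂ Aᶜ.card (fun j => update g l (g l * f) (Aᶜ.orderEmbOfFin rfl j)) =
          (∑ j : Fin A.card, sahiE μ₁ A.card
            (update (fun i => g (A.orderEmbOfFin rfl i)) j ((fun i => g (A.orderEmbOfFin rfl i)) j * f))) *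
            sahiE μ₂ Aᶜ.card (fun j => g (Aᶜ.orderEmbOfFin rfl j)) := by
        rw [← sum_sub_update_mem, Finset.sum_mul]
        refine Finset.sum_congr rfl fun l hl => ?_
        rw [sub_update_of_not_mem g Aᶜ (fun h => (Finset.mem_compl.mp h) hl)]
      have hout : ∑ l ∈ Aᶜ, sahiE μ₁ A.card (fun j => update g l (g l * f) (A.orderEmbOfFin rfl j)) *
            sahiE μ₂ Aᶜ.card (fun j => update g l (g l * f) (Aᶜ.orderEmbOfFin rfl j)) =
          sahiE μ₁ A.card (fun j => g (A.orderEmbOfFin rfl j)) *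
            ∑ j : Fin Aᶜ.card, sahiE μ₂ Aᶜ.card
              (update (fun i => g (Aᶜ.orderEmbOfFin rfl i)) j ((fun i => g (Aᶜ.orderEmbOfFin rfl i)) j * f)) := by
        rw [← sum_sub_update_mem, Finset.mul_sum]
        refine Finset.sum_congr rfl fun l hl => ?_
        rw [sub_update_of_not_mem g A (Finset.mem_compl.mp hl)]
      rw [hin, hout]
      -- the two order-one corrections
      have hc1 : (if A.card = 0 then ex μ₁ f else 0) * sahiE μ₂ Aᶜ.card (fun j => g (Aᶜ.orderEmbOfFin rfl j)) =
          if A = ∅ then ex μ₁ f * sahiE μ₂ (n + 1) g else 0 := by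
        by_cases hA : A = ∅
        · subst hA
          rw [if_pos Finset.card_empty, if_pos rfl, sahiE_sub_congr μ₂ g (Finset.compl_empty), sahiE_sub_univ]
        · rw [if_neg (fun h0 => hA (Finset.card_eq_zero.mp h0)), if_neg hA, zero_mul]
      have hc2 : sahiE μ₁ A.card (fun j => g (A.orderEmbOfFin rfl j)) * (if Aᶜ.card = 0 then ex μ₂ f else 0) =
          if A = univ then ex μ₂ f * sahiE μ₁ (n + 1) g else 0 := by
        by_cases hA : A = univ
        · subst hA
          rw [if_pos (by rw [Finset.compl_univ, Finset.card_empty]), if_pos rfl, sahiE_sub_univ, mul_comm]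
        · rw [if_neg (fun h0 => hA (by rwa [Finset.card_eq_zero, Finset.compl_eq_empty_iff] at h0)), if_neg hA, mul_zero]
      rw [← hc1, ← hc2]
      ring
    -- (3) sum the per-`A` identity over `A`
    have BIG : ∑ l : Fin (n + 1), ∑ A : Finset (Fin (n + 1)),
          sahiE μ₁ A.card (fun j => update g l (g l * f) (A.orderEmbOfFin rfl j)) *
            sahiE μ₂ Aᶜ.card (fun j => update g l (g l * f) (Aᶜ.orderEmbOfFin rfl j)) =
        (∑ A : Finset (Fin (n + 2)),
          sahiE μ₁ A.card (fun j => (Matrix.vecCons f g : Fin (n + 2) → α → ℝ) (A.orderEmbOfFin rfl j)) *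
            sahiE μ₂ Aᶜ.card (fun j => (Matrix.vecCons f g : Fin (n + 2) → α → ℝ) (Aᶜ.orderEmbOfFin rfl j))) +
        (ex μ₁ f + ex μ₂ f) * ∑ A : Finset (Fin (n + 1)), sahiE μ₁ A.card (fun j => g (A.orderEmbOfFin rfl j)) *
            sahiE μ₂ Aᶜ.card (fun j => g (Aᶜ.orderEmbOfFin rfl j)) -
        ex μ₁ f * sahiE μ₂ (n + 1) g - ex μ₂ f * sahiE μ₁ (n + 1) g := by
      rw [Finset.sum_comm, Finset.sum_congr rfl fun A _ => PER A, sum_finset_succ]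
      simp only [Finset.sum_sub_distrib, Finset.sum_add_distrib, ← Finset.mul_sum, Finset.sum_ite_eq', Finset.mem_univ,
        if_true]
      ring
    -- (4) assemble
    rw [Rρ, R1, R2, Xρ, Finset.sum_congr rfl fun l _ => IH (update g l (g l * f)), IH g]
    simp only [Finset.sum_sub_distrib, Finset.sum_add_distrib]
    rw [BIG]
    ring

end WeightSum

end Summit.CriticalPhenomena.PercolationContinuityZ3.Theorems
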